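import Summits.AtomisticToContinuum.Crystallization.Theorems.ChartedZeroExcessLayeredLatticeLiouvilleYE

/-!
# Charted zero-excess layered-lattice Liouville — YF «EnclosureCut» — part 1 of 2 (lens-2 g63; docket `stmt-AtomisticToContinuum-26636`)

Part 1 (this file, `…YFA`): the `CountSparseBPG` sum glue and serenity-radius dial (YF-0), the cut predicates and the doors [CMC] / [CMCᶜ] / [CMG] (YF-1), the
sitewise exclusion and the radiating-lump corollary (YF-2).  Part 2 (`…YF`): the residual leaves [SSHSᵇ] / [BSHSᵇ] and the glue (YF-3), the (E1) kit (YF-4), the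
column `_16XH24B` (YF-5).  This docstring describes the whole node.

Sequel of part YE («SereneCut», g62).  Critic row 1181 (c1)–(c3): the SERENE leaf [SBHSᵇ] `SereneBareHotSparseBPG` of the column of record `_16XH23B`
is cut by the ISOLATION of the hot network around the site, and its special class is KILLED OUTRIGHT (count `0`, not `o(η)`) by a new LOCAL FINITE door.

* **THE CUT (structural dichotomy, special vs generic).**  A serene bare hot site `x` is ISOLATED at scales `(q, D)` (`IsHotIsolated`: every `ϑ`-hot site
  of `S` within `D` of `x` lies within `q` of `x` — the hot network near `x` is a COMPACT BLOB of radius `≤ q` with a hot-free halo of width `D − q`) or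
  LINKED (a hot site at distance `∈ (q, D]`); a linked site is BURIED (`IsBuried b`: its whole `b`-ball is hot — the interior of a FAT lump) or SLENDER
  (a tame site within `b` — thin / extended networks: filaments, sheets, rinds).  `[SBHSᵇ] ⟸ [CMC] ∧ [SSHSᵇ] ∧ [BSHSᵇ]` (PROVED,
  `sereneBareHotSparseBPG_of_coolMoat_slender_buried`): the isolated class is EMPTY under the door [CMC], the two linked classes are sub-counts.
* **[CMC] `CoolMoatCorePG ϑc ϑ r q rsh` — THE COOL-MOAT ENCLOSURE DOOR (special side, NEW, LOCAL, FINITE).**  On a θ-good e⋆-GSC door set with an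
  equilibrium chart `H`: every container `K ⊆ S ∩ B̄(x₀, q)` whose moat `moatIn S K r (r + rsh)` (sites at distance `∈ (r, r + rsh)` from `K`) is
  `ϑc`-TAME (flat level, tilt-blind — exactly what serenity delivers) is `ϑ`-tame.  KEY LEMMA (PROVED, `isTameOn_moat_hotCluster_of_serene`): if `x` is
  serene at radius `ra ≥ r + rsh + q` and isolated at `(q, D)` with `D ≥ 2r + rsh + q`, the moat of its hot cluster `hotCluster ϑ q S H x` consists of
  `ϑ`-tame-`r`-balled observers, hence (serenity) is `ϑc`-cool; so the door makes «hot ∧ serene ∧ isolated» IMPOSSIBLE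
  (`not_hot_serene_isolated_of_coolMoatCore`, PROVED) — no dressing hypothesis is even used.
  Its LOCAL CLAMPED form [CMCᶜ] `CoolMoatClampedCoreP … ρ` (door `IsDoorSetP` + summable pair sums + grand clamped minimality of the ONE finite region
  `coreOf S K ρ`, part UH's currency) is the typed SMALL-DATA UNIQUENESS / INTERIOR-TAMENESS LEAF of row 1181 (c2) (E–Ming 2007, Ortner–Theil 2013,
  Braun–Schmidt 2016: the clamped Lennard-Jones boundary-value problem with `1 %`-cool thick-shell data has only tame clean critical fillings);
  `[CMCᶜ](ρ) ⇒ [CMC]` (PROVED), gap form [CMG] `CoolMoatCoreGapP ⟺ [CMCᶜ]` (PROVED: «a hot cool-moated cluster admits a finite replacement of its `ρ`-core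
  STRICTLY lowering the grand clamped energy» — the finite certificate a computation exhibits instance-wise), `ρ`-dial (PROVED).
* **(E1) `CleanClassHotGapKit c ϑ rc` (row 1181 (c1), TYPED, ASIDE).**  The null-Lagrangian-corrected cell excess as an EXISTENTIAL KIT: a cell functional
  `cell S x`, LOCAL (depends on `S ∩ B̄(x, rc)` only), with FLOOR `≥ 0` on θ-good door sets, GAP `≥ c·ϑ²` at INTRINSICALLY `ϑ`-hot sites (hot for every
  equilibrium chart — stacking-blind, so the `10⁻⁴·ε` fcc/hcp degeneracy does not break it), and BOOKKEEPING `Σ_C cell ≤ Σ_C (e_x − e⋆) + Cbk·#∂_{rc} C`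
  on finite chunks.  PROVED consequence (`wildHotCount_priced_of_kit`): `c·ϑ²·#{intrinsically hot sites of C} ≤ Σ_{x ∈ C} (e_x − e⋆) + Cbk·#∂C` — hot
  sites cost BULK energy, paid only by excess energy or through the boundary.  It is the (K2b) coercivity input of [CMCᶜ]'s mechanism; instrument
  «HotCellGapScan» (NODE memo).  BARRIER-ADJACENT: `Literature.Barriers.AtomisticToContinuum.LocalizedPotentialsExcludeLennardJones` (the cellwise
  positivity classes of Theil 2006 / Flatley–Theil 2015 exclude `V_LJ`); the bet is the CHARTED `1/16`-clean class with tails booked at radius `rc`.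
* **(c3) ISOLATED HOT LUMPS RADIATE (PROVED, `exists_farWarm_moat_of_isolated_hot`)** — the corollary on the [TBISᵇ(r)] side: under [CMC], every hot
  cluster in a `q`-ball with a hot-free halo of width `2r + rsh` has a FAR-WARM observer (tame `r`-ball, star not `ϑc`-tame) in its moat.  So compact
  hot blobs are never silent: they are AGITATED and paid by the observers' leaf [FWSᵇ] ⟸ [TBISᵇ(r)]; the inhabitant shared by [TBISᵇ(8)] and the serene
  side — FAT clean hot lumps — is now NAMED on the serene side as [BSHSᵇ] (buried interiors) and its rind/halo stays on the [TBISᵇ(8)] side.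
* **COLUMN `_16XH24B`** = `_16XH23B` with [SBHSᵇ](ra = 16) replaced by [CMC](1/100, 1/20, 8, 4, 12) ∧ [SSHSᵇ](ra = 24, q = 4, D = 32, b = 8) ∧
  [BSHSᵇ](ra = 24, b = 8); [SBHSᵇ] is ANTITONE in `ra` (`SereneBareHotSparseBPG.of_ra_le`, PROVED), so both residuals are WEAKER than the leaf of record
  (`slender_and_buried_of_serene`, PROVED); [CMC] is a NEW finite door (not implied by the docket of record; it REPLACES the compact part of an
  IDEA-NEEDED leaf by an ATTACKABLE·L finite statement, as [CG₁] did for [I_D]).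
WHY THIS IS NOVEL.  Parts UC–UH cut hot stars by amplitude, collar, connectivity, profile and COUNT against envelope-dressed (tilt-aware) moats of `≤ M`-site
containers; parts YC–YE priced the generic side in (M)/(K) count currency and isolated SERENITY.  Part YF observes that serenity is itself FLAT TILT-BLIND
BOUNDARY DATA: for an ISOLATED hot blob the serene observers FORM a complete cool moat, so the special class needs no excision calculus at all — it is a
bounded clamped boundary-value problem ([CMC]/[CMG]), of any cardinality inside a `q`-ball; the residual is cut by BURIAL DEPTH, which is the variable
that separates the two remaining mechanisms (filament/sheet excision with cut-end costs vs volume-vs-surface for fat lumps).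
WHY EACH PIECE IS STRICTLY WEAKER / WHERE IT SITS.  [SSHSᵇ], [BSHSᵇ] ⟸ [SBHSᵇ](ra = 24) ⟸ [SBHSᵇ](16) ⟸ [BHSᵇ] (sub-counts, PROVED).  [CMC] is a side door
(LOCAL, FINITE, registration-free, window-free), incomparable with [I_D] (flat tilt-blind `1 %` moat of thickness `rsh` vs envelope tilt-aware moat `(8,16)`,
containers in a `q`-ball vs `≤ M` sites); `[CMCᶜ] ⇒ [CMC]`, `[CMG] ⟺ [CMCᶜ]`.  (E1) is an ASIDE (not in the cone of `_16XH24B`).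
No sorry, no new axiom, no instances / notations / option overrides; classical indicators via `open scoped Classical` (parts YC–YE precedent).
-/

noncomputable section

open scoped BigOperators Classical
open MeasureTheory Set Metric Filter Topology
open Summit.AtomisticToContinuum.Crystallization.Theorems.ChartedPlanarOrderRigidityDoor (E3 eStar atomsIn IsEStarGSC siteEnergy VisibleGap PertRegime)
open Summit.AtomisticToContinuum.Crystallization.Theorems.ChartedPlanarOrderDensityDichotomy (μS IsSep nK nK_nonneg)
open Summit.AtomisticToContinuum.Crystallization.Theorems.ChartedPlanarOrderCleanScaleP (IsCleanP IsDoorSetP)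
open Summit.AtomisticToContinuum.Crystallization.Theorems.ChartedPlanarOrderMesoCut (LayeredHom EnvClose)
open Summit.AtomisticToContinuum.Crystallization.Theorems.ChartedPlanarOrderDoorLayered (atomsIn_subset sq_le_finsum_mem PeriodicBulkGapDoor)
open Summit.AtomisticToContinuum.Crystallization.Theorems.ChartedPlanarOrderDoorLayeredOsc (IsTwoShellAffineGood)
open Literature.MathematicalPhysics.StatisticalMechanics (card_le_of_separated_of_dist_le lennardJones)

namespace Summit.AtomisticToContinuum.Crystallization.Theorems.ChartedZeroExcessLayeredLatticeLiouville

/-! ### YF-0  Two more lines of the `CountSparseBPG` calculus: sums of leaves, and the serenity-radius dial of [SBHSᵇ] -/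

/-- SUM GLUE (PROVED): `cntA ≤ cntB + cntC` on windows of separated sets, `cntC` monotone in the window ⇒ `[cntB sparse] ∧ [cntC sparse] ⇒ [cntA sparse]`
(`aHi ≤ 8/7`) — part YEA's charging glue at radius `ρ = 0`, constant `1`. [this file, g63] -/
theorem CountSparseBPG.of_le_add {cntA cntB cntC : Set E3 → Set E3 → (E3 → E3) → Set E3 → ℝ} {aHi Λ θ s : ℝ} (haHi : aHi ≤ 8 / 7)
    (hle : ∀ δ : ℝ, 0 < δ → ∀ S : Set E3, IsSep δ S → ∀ (H : Set E3) (Ψ : E3 → E3) (R : ℝ),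
      cntA S H Ψ (atomsIn (μS S) 0 R) ≤ cntB S H Ψ (atomsIn (μS S) 0 R) + cntC S H Ψ (atomsIn (μS S) 0 R))
    (hmono : ∀ (S H : Set E3) (Ψ : E3 → E3) (Q Q' : Set E3), Q'.Finite → Q ⊆ Q' → cntC S H Ψ Q ≤ cntC S H Ψ Q')
    (hB : CountSparseBPG cntB aHi Λ θ s) (hC : CountSparseBPG cntC aHi Λ θ s) : CountSparseBPG cntA aHi Λ θ s :=
  CountSparseBPG.of_le_add_mul (ρ := 0) (C := fun _ => 1) haHi (fun _ _ => one_pos)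
    (fun δ hδ S hsep H Ψ R => by rw [add_zero, one_mul]; exact hle δ hδ S hsep H Ψ R) hmono hB hC

/-- agitation is monotone in the serenity radius. [this file, g63] -/
theorem IsAgitated.of_ra_le {ϑc ϑ r ra ra' : ℝ} (h : ra ≤ ra') {S H : Set E3} {x : E3} (hx : IsAgitated ϑc ϑ r ra S H x) :
    IsAgitated ϑc ϑ r ra' S H x := by
  obtain ⟨y, hy, hd, hw⟩ := hx
  exact ⟨y, hy, hd.trans h, hw⟩

/-- the serene bare hot count is ANTITONE in the serenity radius. [this file, g63] -/
theorem sereneBareHotCount_anti_ra {ϑc ϑ r ra ra' ϑe ωe : ℝ} {p : ℕ} {r₀ ℓ : ℝ} {M : ℕ} (h : ra ≤ ra') {S H Q : Set E3} (hQ : Q.Finite) :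
    sereneBareHotCount ϑc ϑ r ra' ϑe ωe p r₀ ℓ M S H Q ≤ sereneBareHotCount ϑc ϑ r ra ϑe ωe p r₀ ℓ M S H Q := by
  rw [sereneBareHotCount, sereneBareHotCount, finsum_mem_eq_finite_toFinset_sum _ hQ, finsum_mem_eq_finite_toFinset_sum _ hQ]
  refine Finset.sum_le_sum fun x _ => ?_
  by_cases hd : IsDressed ϑe ωe p r₀ ℓ M S H x ∨ IsTameStar ϑ S H x ∨ IsAgitated ϑc ϑ r ra S H x
  · rw [if_pos hd, if_pos (hd.imp_right (Or.imp_right (IsAgitated.of_ra_le h)))]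
  · rw [if_neg hd]
    split_ifs <;> norm_num

/-- ★ **[SBHSᵇ](ra) ⇒ [SBHSᵇ](ra') for `ra ≤ ra'` (PROVED)** — a larger serenity radius agitates more sites, so the serene leaf WEAKENS; the charging glue of
part YE holds for every `ra ≥ 0`, so the column may raise `ra` at no cost. [this file, g63] -/
theorem SereneBareHotSparseBPG.of_ra_le {ϑc ϑ r ra ra' ϑe ωe : ℝ} {p : ℕ} {r₀ ℓ : ℝ} {M : ℕ} {aHi Λ θ s : ℝ} (h : ra ≤ ra')
    (hS : SereneBareHotSparseBPG ϑc ϑ r ra ϑe ωe p r₀ ℓ M aHi Λ θ s) : SereneBareHotSparseBPG ϑc ϑ r ra' ϑe ωe p r₀ ℓ M aHi Λ θ s :=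
  CountSparseBPG.of_pointwise_le (fun _ _ _ _ hQ _ _ => sereneBareHotCount_anti_ra h hQ) hS

/-! ### YF-1  Isolation, burial, the hot cluster; the cool-moat enclosure door [CMC], its clamped form [CMCᶜ] and gap form [CMG] -/

/-- **`IsHotIsolated ϑ q D S H x`** — the hot network near `x` is a COMPACT BLOB: every site of `S` within `D` of `x` that is not `ϑ`-tame lies within `q` of
`x` (hot-free halo `q < d ≤ D`).  Its negation — LINKED: a hot site at distance `∈ (q, D]` — is the generic class of the cut. [this file, g63] -/
def IsHotIsolated (ϑ q D : ℝ) (S H : Set E3) (x : E3) : Prop :=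
  ∀ z ∈ S, dist z x ≤ D → ¬ IsTameStar ϑ S H z → dist z x ≤ q

/-- **`IsBuried ϑ b S H x`** — every site of `S` within `b` of `x` (including `x`) is `ϑ`-hot: `x` lies at depth `≥ b` inside a FAT hot lump. [this file, g63] -/
def IsBuried (ϑ b : ℝ) (S H : Set E3) (x : E3) : Prop :=
  ∀ y ∈ S, dist y x ≤ b → ¬ IsTameStar ϑ S H y

/-- **`hotCluster ϑ q S H x`** — the hot sites of `S` within `q` of `x` (the container the door is applied to). [this file, g63] -/
def hotCluster (ϑ q : ℝ) (S H : Set E3) (x : E3) : Set E3 := {z | z ∈ S ∧ dist z x ≤ q ∧ ¬ IsTameStar ϑ S H z}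

/-- ★★★ **[CMC] «CoolMoatCorePG ϑc ϑ r q rsh aHi Λ θ s» — THE COOL-MOAT ENCLOSURE DOOR.**  For every θ-good `aHi`-door e⋆-GSC set `S` (`IsDoorSetPG`),
every equilibrium `s`-chart `(L, w)` about scale `a`, every centre `x₀` and every container `K ⊆ S` inside `B̄(x₀, q)` (any cardinality): IF every site of
the moat `moatIn S K r (r + rsh)` (distance `∈ (r, r + rsh)` from `K`) is `ϑc`-TAME relative to `H = LayeredHom L w` (FLAT level, TILT-BLIND: part UC's
`IsTameStar`), THEN every site of `K` is `ϑ`-tame.  The enclosure lemma «no hot site inside a cool shell» for BOUNDED blobs, as a door; what serenity of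
an isolated hot blob delivers is exactly its hypothesis (`isTameOn_moat_hotCluster_of_serene`).  Monotone: WEAKER as `ϑ`, `rsh` grow, STRONGER as `ϑc`,
`q` grow.  Record `(ϑc, ϑ, r, q, rsh) = (1/100, 1/20, 8, 4, 12)`: containers in a `4`-ball (`≲ 3·10²` sites), moat `(8, 20)` of thickness `12` at `1 %`.
MECHANISM (what a proof must do; cf. part UH [CG]): (K0) WORD — the stacking word of the clean charted core is that of its moat (c-planes cannot end
without unclean partials; tree `WordTransplantP`-type, kinematic); (K1) FRAME — a `1 %`-tame annulus of thickness `12` in a clean set carries ONE rotation up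
to `C·ϑc` (Friesecke–James–Müller on an annulus; the dormant (α) lane `TameBallTiltRigidityP`), so tilt-blind data are tilt-aware data for a rotated chart,
and `IsTameStar` is chart-rotation invariant; (K2a) linearised stability of the chart — the column's (U♮ᴱ) `UniformTameStabilityE`; (K2b) the nonlinear
clean-class hot gap — (E1) `CleanClassHotGapKit` below; (K3) SLAVING / small-data uniqueness of the clamped filling — [CMCᶜ] is the typed leaf.
NEW · LOCAL · FINITE · GSC-priced · UNDECIDED · ATTACKABLE·L (computer-assisted, the [CG₁] technology on a `≤ 20`-ball) · INSTRUMENTABLE («CoolMoatGap»: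
multistart clamped relaxation of `4`-ball hot seeds under admissible `1 %`-strained, slowly rotated tame exteriors of thickness `12`; kill sign = a clean
single-site-Nash end state with a `1/20`-hot site in the seed ball and grand clamped energy `≤` that of the returned tame filling).
Why it might fail: elastic bistability of the clamped Lennard-Jones `20`-ball under `≤ 1 %` tilt-blind shell data — a second clean charted Nash filling hot at
the centre (soft tension corner `r ≈ 17/16`); none known, (F0d′) `0/168` clean hot fillings under envelope data; the flat `1 %` data are rougher than [I_D]'s.
Sources: part UH ([CG], [CG₁], `IsGrandClampedMin`); part YE (serenity); E–Ming, Arch. Ration. Mech. Anal. 183 (2007) 241; Ortner–Theil, Arch. Ration. Mech.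
Anal. 207 (2013) 1025; Braun–Schmidt, arXiv 1604.00197; Friesecke–James–Müller, Comm. Pure Appl. Math. 55 (2002) Thm 3.1; Ehrlacher–Ortner–Shapeev, Arch.
Ration. Mech. Anal. 222 (2016) 1217; census F0ZOO24.md; CRITIC-LEDGER row 1181 (c). [this file, g63] -/
def CoolMoatCorePG (ϑc ϑ r q rsh aHi Λ θ s : ℝ) : Prop :=
  ∀ δ : ℝ, 0 < δ → ∀ a : ℝ, 0 < a →
    ∀ S : Set E3, IsDoorSetPG aHi δ S → (∀ p ∈ S, IsTwoShellAffineGood θ S p) →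
      ∀ (L : E3 ≃L[ℝ] E3) (w : ℤ → E3), IsEquilChart a s Λ L w →
        ∀ (x₀ : E3) (K : Set E3), K ⊆ S → (∀ k ∈ K, dist k x₀ ≤ q) →
          IsTameOn ϑc S (LayeredHom (L : E3 →L[ℝ] E3) w) (moatIn S K r (r + rsh)) →
            IsTameOn ϑ S (LayeredHom (L : E3 →L[ℝ] E3) w) K

/-- ★★ **[CMCᶜ] «CoolMoatClampedCoreP ϑc ϑ r q rsh ρ aHi Λ θ s» — THE SMALL-DATA UNIQUENESS LEAF (row 1181 (c2)), [CMC] in LOCAL CLAMPED form.**  For every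
θ-good `aHi`-door set `S` (`IsDoorSetP`: NO grand-canonical hypothesis on the whole of `S`) with summable pair sums, equilibrium chart, centre `x₀`, container
`K ⊆ S ∩ B̄(x₀, q)` with `ϑc`-tame moat `moatIn S K r (r + rsh)`: IF the `ρ`-core `coreOf S K ρ` is a GRAND CLAMPED MINIMISER of `S` (part UH: the `IsEStarGSC`
clause at that ONE finite region), THEN `K` is `ϑ`-tame — uniqueness-up-to-tameness of the clean clamped Lennard-Jones filling of a bounded hole under `1 %`-cool
thick-shell data (E–Ming / Ortner–Theil Cauchy–Born stability is its perturbative germ, `ϑc ≲ 1/200`; at `ϑc = 1/100` it is a genuine leaf, g61).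
`[CMCᶜ](ρ) ⇒ [CMC]` (PROVED), `⟺ [CMG](ρ)` (PROVED), WEAKER as `ρ` grows (PROVED).  Record `ρ = 16` (core `B̄(x₀, ≤ 20)`, frozen cool layer `(16, 20)` of the moat).
LOCAL · FINITE · UNDECIDED · ATTACKABLE·L · INSTRUMENTABLE («CoolMoatGap»).  Why it might fail / Sources: as [CMC]. [this file, g63] -/
def CoolMoatClampedCoreP (ϑc ϑ r q rsh ρ aHi Λ θ s : ℝ) : Prop :=
  ∀ δ : ℝ, 0 < δ → ∀ a : ℝ, 0 < a →
    ∀ S : Set E3, IsDoorSetP aHi δ S → (∀ z : E3, Summable fun y : S => lennardJones (dist z (y : E3))) →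
      (∀ p ∈ S, IsTwoShellAffineGood θ S p) →
        ∀ (L : E3 ≃L[ℝ] E3) (w : ℤ → E3), IsEquilChart a s Λ L w →
          ∀ (x₀ : E3) (K : Set E3), K ⊆ S → (∀ k ∈ K, dist k x₀ ≤ q) →
            IsTameOn ϑc S (LayeredHom (L : E3 →L[ℝ] E3) w) (moatIn S K r (r + rsh)) →
              IsGrandClampedMin S (coreOf S K ρ) → IsTameOn ϑ S (LayeredHom (L : E3 →L[ℝ] E3) w) K

/-- ★★ **[CMG] «CoolMoatCoreGapP ϑc ϑ r q rsh ρ aHi Λ θ s» — THE FINITE CERTIFICATE FORM**: under the binders of [CMCᶜ], if `K` contains a `ϑ`-HOT site then for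
SOME enumeration `xf` of the `ρ`-core there is an injective replacement `R` of SOME count, avoiding the frozen exterior, with `clampedEnergy − e⋆·k` STRICTLY
below that of `xf` (the negation of the `IsEStarGSC` clause at that region).  `⟺ [CMCᶜ]` (PROVED). [this file, g63] -/
def CoolMoatCoreGapP (ϑc ϑ r q rsh ρ aHi Λ θ s : ℝ) : Prop :=
  ∀ δ : ℝ, 0 < δ → ∀ a : ℝ, 0 < a →
    ∀ S : Set E3, IsDoorSetP aHi δ S → (∀ z : E3, Summable fun y : S => lennardJones (dist z (y : E3))) →
      (∀ p ∈ S, IsTwoShellAffineGood θ S p) →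
        ∀ (L : E3 ≃L[ℝ] E3) (w : ℤ → E3), IsEquilChart a s Λ L w →
          ∀ (x₀ : E3) (K : Set E3), K ⊆ S → (∀ k ∈ K, dist k x₀ ≤ q) →
            IsTameOn ϑc S (LayeredHom (L : E3 →L[ℝ] E3) w) (moatIn S K r (r + rsh)) →
              (∃ x ∈ K, ¬ IsTameStar ϑ S (LayeredHom (L : E3 →L[ℝ] E3) w) x) →
                ∃ (n : ℕ) (xf : Fin n → E3), Function.Injective xf ∧ Set.range xf = coreOf S K ρ ∧
                  ∃ (k : ℕ) (R : Fin k → E3), Function.Injective R ∧ Disjoint (Set.range R) (S \ coreOf S K ρ) ∧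
                    clampedEnergy (S \ coreOf S K ρ) R - eStar * k < clampedEnergy (S \ coreOf S K ρ) xf - eStar * n

/-- ★★ **[CMCᶜ](ρ) ⇒ [CMC] (PROVED, every `ρ`)** — on an e⋆-GSC door set the `ρ`-core of every container is grand-clamped-minimal and the pair sums are summable. -/
theorem coolMoatCorePG_of_clamped {ϑc ϑ r q rsh ρ aHi Λ θ s : ℝ} (h : CoolMoatClampedCoreP ϑc ϑ r q rsh ρ aHi Λ θ s) :
    CoolMoatCorePG ϑc ϑ r q rsh aHi Λ θ s :=
  fun δ hδ a ha S hS hgood L w hLw x₀ K hKS hKq hcool =>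
    h δ hδ a ha S hS.isDoorSetP (summable_of_isEStarGSC hS.gsc) hgood L w hLw x₀ K hKS hKq hcool
      (isGrandClampedMin_of_isEStarGSC hS.gsc (coreOf_subset S K ρ))

/-- ★ **[CMCᶜ] ⟺ [CMG] (PROVED)** — contraposition at the one region, `not_isGrandClampedMin_iff` of part UH. [this file, g63] -/
theorem coolMoatClampedCoreP_iff_gap {ϑc ϑ r q rsh ρ aHi Λ θ s : ℝ} :
    CoolMoatClampedCoreP ϑc ϑ r q rsh ρ aHi Λ θ s ↔ CoolMoatCoreGapP ϑc ϑ r q rsh ρ aHi Λ θ s := by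
  constructor
  · intro h δ hδ a ha S hS hsum hgood L w hLw x₀ K hKS hKq hcool hex
    obtain ⟨x, hxK, hot⟩ := hex
    exact not_isGrandClampedMin_iff.1 fun hmin => hot (h δ hδ a ha S hS hsum hgood L w hLw x₀ K hKS hKq hcool hmin x hxK)
  · intro h δ hδ a ha S hS hsum hgood L w hLw x₀ K hKS hKq hcool hmin x hxK
    by_contra hot
    exact not_isGrandClampedMin_iff.2 (h δ hδ a ha S hS hsum hgood L w hLw x₀ K hKS hKq hcool ⟨x, hxK, hot⟩) hmin

/-- ★ **THE CLAMP-RADIUS DIAL (PROVED): `[CMCᶜ](ρ) ⇒ [CMCᶜ](ρ')` for `ρ ≤ ρ'`** — a container in a `q`-ball of a separated set is finite, so grand clamped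
minimality of the larger core gives the smaller core's (`IsGrandClampedMin.anti`). [this file, g63] -/
theorem CoolMoatClampedCoreP.of_le {ϑc ϑ r q rsh ρ ρ' aHi Λ θ s : ℝ} (hρ : ρ ≤ ρ') (h : CoolMoatClampedCoreP ϑc ϑ r q rsh ρ aHi Λ θ s) :
    CoolMoatClampedCoreP ϑc ϑ r q rsh ρ' aHi Λ θ s := by
  intro δ hδ a ha S hS hsum hgood L w hLw x₀ K hKS hKq hcool hmin
  have hKf : K.Finite :=
    (Literature.Probability.Process.LocalConfig.finite_inter_of_separated hδ hS.2.1 (isCompact_closedBall x₀ q)).subset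
      fun k hk => ⟨mem_closedBall.2 (hKq k hk), hKS hk⟩
  exact h δ hδ a ha S hS hsum hgood L w hLw x₀ K hKS hKq hcool
    (hmin.anti hsum (coreOf_subset S K ρ') (coreOf_finite hδ hS.2.1 hKf ρ') (coreOf_mono S K hρ))

/-! ### YF-2  Serenity of an isolated blob is a cool moat: the sitewise exclusion, and the radiating-lump corollary (c3) -/

/-- ★★ **KEY LEMMA (PROVED): the moat of the hot cluster of a SERENE ISOLATED site is `ϑc`-COOL.**  If `x` is serene at radius `ra ≥ r + rsh + q` and isolated
at `(q, D)` with `D ≥ 2r + rsh + q`, every site `y` of `moatIn S (hotCluster ϑ q S H x) r (r + rsh)` has a `ϑ`-tame `r`-ball (a hot `z` within `r` of `y` would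
lie within `D` of `x`, hence in the cluster, hence farther than `r` from `y`) and lies within `ra` of `x`; not being a far-warm observer, it is `ϑc`-tame. -/
theorem isTameOn_moat_hotCluster_of_serene {ϑc ϑ r ra q rsh D : ℝ} (hra : r + rsh + q ≤ ra) (hD : 2 * r + rsh + q ≤ D) {S H : Set E3} {x : E3}
    (hser : ¬ IsAgitated ϑc ϑ r ra S H x) (hiso : IsHotIsolated ϑ q D S H x) :
    IsTameOn ϑc S H (moatIn S (hotCluster ϑ q S H x) r (r + rsh)) := by
  intro y hy
  obtain ⟨hyS, ⟨k, hk, hyk⟩, hfar⟩ := mem_moatIn.1 hy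
  have hkx : dist k x ≤ q := hk.2.1
  have hyx' : dist y x ≤ dist y k + dist k x := dist_triangle y k x
  have hyx : dist y x ≤ ra := by linarith
  have hball : IsTameBall ϑ r S H y := by
    intro z hzS hzy
    by_contra hzt
    have hzx' : dist z x ≤ dist z y + dist y x := dist_triangle z y x
    have hzx : dist z x ≤ D := by linarith
    have hzr : r < dist y z := hfar z ⟨hzS, hiso z hzS hzx hzt, hzt⟩
    rw [dist_comm] at hzy
    linarith
  by_contra hyc
  exact hser ⟨y, hyS, hyx, hball, hyc⟩

/-- ★★★ **SITEWISE EXCLUSION (PROVED): under [CMC] no site of a θ-good e⋆-GSC door set is HOT ∧ SERENE ∧ ISOLATED** (`0 ≤ q`, `ra ≥ r + rsh + q`,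
`D ≥ 2r + rsh + q`): apply the door to the hot cluster of `x`, whose moat is cool by the key lemma; `x` belongs to its own cluster.  No dressing
hypothesis is used — the special class of the cut is EMPTY, not merely sparse. [this file, g63] -/
theorem not_hot_serene_isolated_of_coolMoatCore {ϑc ϑ r ra q rsh D aHi Λ θ s : ℝ} (hq : 0 ≤ q) (hra : r + rsh + q ≤ ra) (hD : 2 * r + rsh + q ≤ D)
    (hC : CoolMoatCorePG ϑc ϑ r q rsh aHi Λ θ s) {δ : ℝ} (hδ : 0 < δ) {a : ℝ} (ha : 0 < a) {S : Set E3} (hS : IsDoorSetPG aHi δ S)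
    (hgood : ∀ p ∈ S, IsTwoShellAffineGood θ S p) {L : E3 ≃L[ℝ] E3} {w : ℤ → E3} (hLw : IsEquilChart a s Λ L w) {x : E3} (hx : x ∈ S)
    (hot : ¬ IsTameStar ϑ S (LayeredHom (L : E3 →L[ℝ] E3) w) x) (hser : ¬ IsAgitated ϑc ϑ r ra S (LayeredHom (L : E3 →L[ℝ] E3) w) x) :
    ¬ IsHotIsolated ϑ q D S (LayeredHom (L : E3 →L[ℝ] E3) w) x := fun hiso =>
  hot (hC δ hδ a ha S hS hgood L w hLw x (hotCluster ϑ q S (LayeredHom (L : E3 →L[ℝ] E3) w) x) (fun _ hz => hz.1) (fun _ hk => hk.2.1)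
    (isTameOn_moat_hotCluster_of_serene hra hD hser hiso) x ⟨hx, by rw [dist_self]; exact hq, hot⟩)

/-- ★★ **(c3) ISOLATED HOT LUMPS RADIATE (PROVED)** — the corollary on the [TBISᵇ(r)] / [FWSᵇ] side: under [CMC], if a `ϑ`-hot site `z₀` lies within `q` of
`x₀` and every hot site within `2r + rsh + q` of `x₀` lies within `q` of `x₀` (a COMPACT hot blob with a hot-free halo, of any cardinality), then the
moat of the blob contains a FAR-WARM OBSERVER (tame `r`-ball, star not `ϑc`-tame).  Compact blobs are therefore always AGITATED — charged to the
observers' leaf [FWSᵇ] ⟸ [TBISᵇ(r)] — and the only SILENT hot structures are linked ones: slender networks and buried lump interiors. [this file, g63] -/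
theorem exists_farWarm_moat_of_isolated_hot {ϑc ϑ r q rsh aHi Λ θ s : ℝ} (hC : CoolMoatCorePG ϑc ϑ r q rsh aHi Λ θ s) {δ : ℝ} (hδ : 0 < δ) {a : ℝ}
    (ha : 0 < a) {S : Set E3} (hS : IsDoorSetPG aHi δ S) (hgood : ∀ p ∈ S, IsTwoShellAffineGood θ S p) {L : E3 ≃L[ℝ] E3} {w : ℤ → E3}
    (hLw : IsEquilChart a s Λ L w) {x₀ z₀ : E3} (hz₀ : z₀ ∈ S) (hz₀x : dist z₀ x₀ ≤ q) (hot : ¬ IsTameStar ϑ S (LayeredHom (L : E3 →L[ℝ] E3) w) z₀)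
    (hiso : ∀ z ∈ S, dist z x₀ < 2 * r + rsh + q → ¬ IsTameStar ϑ S (LayeredHom (L : E3 →L[ℝ] E3) w) z → dist z x₀ ≤ q) :
    ∃ y ∈ moatIn S (hotCluster ϑ q S (LayeredHom (L : E3 →L[ℝ] E3) w) x₀) r (r + rsh), IsFarWarm ϑc ϑ r S (LayeredHom (L : E3 →L[ℝ] E3) w) y := by
  by_contra hno
  have hcool : IsTameOn ϑc S (LayeredHom (L : E3 →L[ℝ] E3) w) (moatIn S (hotCluster ϑ q S (LayeredHom (L : E3 →L[ℝ] E3) w) x₀) r (r + rsh)) := by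
    intro y hy
    obtain ⟨hyS, ⟨k, hk, hyk⟩, hfar⟩ := mem_moatIn.1 hy
    have hkx : dist k x₀ ≤ q := hk.2.1
    have hyx' : dist y x₀ ≤ dist y k + dist k x₀ := dist_triangle y k x₀
    have hball : IsTameBall ϑ r S (LayeredHom (L : E3 →L[ℝ] E3) w) y := by
      intro z hzS hzy
      by_contra hzt
      have hzx' : dist z x₀ ≤ dist z y + dist y x₀ := dist_triangle z y x₀
      have hzx : dist z x₀ < 2 * r + rsh + q := by linarith
      have hzr : r < dist y z := hfar z ⟨hzS, hiso z hzS hzx hzt, hzt⟩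
      rw [dist_comm] at hzy
      linarith
    by_contra hyc
    exact hno ⟨y, hy, hball, hyc⟩
  exact hot (hC δ hδ a ha S hS hgood L w hLw x₀ _ (fun _ hz => hz.1) (fun _ hk => hk.2.1) hcool z₀ ⟨hz₀, hz₀x, hot⟩)

end Summit.AtomisticToContinuum.Crystallization.Theorems.ChartedZeroExcessLayeredLatticeLiouville

end
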